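import Summits.QuantumFields.YangMills.Theorems.IR.BlockedActivityWMeshCofinal
import HarnessLib

/-!
# Crux `IR` (stmt-QuantumFields-19354), lane B «strong coupling AFTER BLOCKING»: the universal onset is GRADE-ROBUST — any admissible `(n, ε)` at
# some mesh gives EVERY grade `(n', ε')` at all large multiples of that mesh (every `β`; format theorem, no W-class, no `β`-loss)

Helper module for item `stmt-QuantumFields-19354` (`--supports`; it closes nothing), lane `ym-19354-onsetsc-p2` (g6); sequel of
`Theorems/IR/BlockedActivityWMeshCofinal` (`univShellCond_coarsen`: coarse window `1`).

* ★ `univShellCond_coarsen_window` — `UnivShellCond ρ β b n ε` (`b ≥ 1`, `ε ≥ 0`, continuous `ρ`, Hausdorff second-countable `G`), `n' ≥ 1`, `K ≥ 1`,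
  `j(2n+1) ≤ 2K` ⇒ **`UnivShellCond ρ β (K·b) n' (K⁴·(ε·shellCount n)^j)`** — the coarse WINDOW is arbitrary (the recursion is shape-blind; a thicker coarse
  collar only helps); same refinement ∕ peeling proof as `univShellCond_coarsen`.
* ★ `univShellCond_cofinal_window` — with `ε·shellCount n < 1`: for every `n' ≥ 1` and `ε' > 0` there is `K₀` with `UnivShellCond ρ β (K·b) n' ε'` for all
  `K ≥ K₀`.
* ★ `univOnsetAt_grade_robust` — per `(G, ρ)`: a universal onset at SOME admissible grade `(n, ε)` (`ε·shellCount n < 1`) implies the universal onset at EVERY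
  grade `(n', ε')`, `n' ≥ 1`, `ε' > 0`, with the SAME `β₂`; `univOnsetAt_iff_grade_one` — canonical single-grade form `(1, 1∕3552)`;
  `onsetMixing_iff_grade_one : OnsetMixing ↔` «every compact simple `G`, every `r`: `∃ β₂, ∀ β ≥ β₂, ∃ b ≥ 1, UnivShellCond r.ρ β b 1 (1∕3552)`».
  So the grade `(n, ε)` is NOT a degree of freedom of the universal onset statements (the `ε·shellCount n < 1` versus `≤ 3∕4` thresholds of the expired and
  registered stubs, bridged by the bootstrap p522910 at fixed mesh, collapse at the level of meshes-up-to-multiples); the only datum is the mesh `b(β)` up to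
  a `β`-INDEPENDENT factor `K₀(n, ε; n', ε')` — relevant to THE NUMBER §A‴ (the NT calibration `a(β)·b(β) < T` is insensitive to the grade).

HONEST FRAMING: format bookkeeping valid at every `β`; the universal shell condition at some mesh is ASSUMED, never proved; nothing about the onset at
`b(β) ≍ ξ(β)`, a gap or Clay.  No `sorry`; axioms ⊆ {propext, Classical.choice, Quot.sound}; no instances, no notation.
-/

set_option autoImplicit false

noncomputable section

open MeasureTheory ProbabilityTheory Filter Topology
open Literature.MathematicalPhysics
open Literature.MathematicalPhysics.QuantumFieldTheory (LatticeRep IsCompactSimpleLieGroup)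
open Literature.MathematicalPhysics.QuantumLattice
open Summit.QuantumFields.YangMills.Cruxes.IR.Tempered (cellEdges windowCells regionEdges collarEdges)
open Summit.QuantumFields.YangMills.Cruxes.IR.CellTempered.Engine (frameCell frameCell_eq_iff mem_cellEdges_frameCell frame_hC1 finite_frameCell
  regionEdges_union shiftFrame shiftFrame_mesh)
open Summit.QuantumFields.YangMills.Cruxes.IR.OnsetFormats (shellCount UnivShellCond OnsetMixing)
open Summit.QuantumFields.YangMills.Cruxes.IR.AfPincerUc.Calibration (windowCells_subset_windowCellsPlus)
open Summit.QuantumFields.YangMills.Theorems.FiniteSizeCriterion (multiCell_influence_general)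

namespace Summit.QuantumFields.YangMills.Cruxes.IR.BlockedActivity

/-! ## §1 Coarsening to an arbitrary coarse window -/

section CoarsenWindow

variable {G : Type} [Group G] [TopologicalSpace G] [IsTopologicalGroup G] [CompactSpace G] [MeasurableSpace G] [BorelSpace G]
  [SecondCountableTopology G] [T2Space G] {N : ℕ} (ρ : G →* Matrix (Fin N) (Fin N) ℂ)

/-- ★ **THE FORMAT COARSENS, any coarse window.**  For continuous `ρ`: `UnivShellCond ρ β b n ε` (`b ≥ 1`, `ε ≥ 0`), `n' ≥ 1`, `K ≥ 1` and `j(2n+1) ≤ 2K` ⇒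
`UnivShellCond ρ β (K·b) n' (K⁴ · (ε·shellCount n)^j)`. -/
theorem univShellCond_coarsen_window (hρ : Continuous ρ) {β ε : ℝ} {b n : ℕ} (hb : 1 ≤ b) (hε : 0 ≤ ε) (hU : UnivShellCond ρ β b n ε)
    {n' : ℕ} (hn' : 1 ≤ n') (j : ℕ) {K : ℕ} (hK1 : 1 ≤ K) (hK : j * (2 * n + 1) ≤ 2 * K) :
    UnivShellCond ρ β (K * b) n' ((K : ℝ) ^ 4 * (ε * shellCount n) ^ j) := by
  classical
  intro w hw Y hY h0 σ σ' hagree f hf hfm hf01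
  have hw' : AfPincerUc.IsFrame (K * b) w := hw
  have hu : AfPincerUc.IsFrame b (refineFrame K b w) := isFrame_refineFrame hK1 hw'
  have hKb : 1 ≤ K * b := Nat.one_le_iff_ne_zero.2 (Nat.mul_ne_zero (by omega) (by omega))
  have hw1 := frame_step hw' hKb
  have hKpos : (0 : ℤ) < (K : ℤ) := by exact_mod_cast hK1
  have hγ := QuantumFieldTheory.isSpecification_ymSpecification_of_t2Space (d := 4) ρ hρ β
  have hθ : 0 ≤ (ε * shellCount n) ^ j := pow_nonneg (mul_nonneg hε (shellCount_nonneg' n)) j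
  set Y0 : Finset Cell := (cellEdges w 0).image (frameCell (refineFrame K b w)) with hY0
  have hbox := fineCells_centre_subset hK1 hb hw'
  have hdep : DependsOn f {v | frameCell (refineFrame K b w) v ∈ Y0} := by
    intro U V hUV
    refine hf fun e he => hUV e ?_
    show frameCell (refineFrame K b w) e ∈ Y0
    rw [hY0]
    exact Finset.mem_image_of_mem (frameCell (refineFrame K b w)) (Finset.mem_coe.1 he)
  have hR : ∀ (Λ : Finset (ZdEdge 4)), (∀ v v', frameCell (refineFrame K b w) v = frameCell (refineFrame K b w) v' → v ∈ Λ → v' ∈ Λ) →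
      ∀ (y : Cell) (g : LGConfig 4 G → ℝ), Measurable g → (∀ σ, 0 ≤ g σ ∧ g σ ≤ 1) →
      DependsOn g {v | frameCell (refineFrame K b w) v = y} →
      ∀ ζ ζ' : LGConfig 4 G, (∀ v, v ∉ Λ → (∀ i, |frameCell (refineFrame K b w) v i - y i| ≤ j * (2 * n + 1)) → ζ v = ζ' v) →
        |∫ σ, g σ ∂(ymSpecification ρ β Λ ζ) - ∫ σ, g σ ∂(ymSpecification ρ β Λ ζ')| ≤ (ε * shellCount n) ^ j :=
    fun Λ hΛ y g hgm hg01 hgdep ζ ζ' hag => univShellCond_cell_decay ρ hρ hb hε hU hu j Λ hΛ y g hgm hg01 hgdep ζ ζ' hag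
  have hagree' : ∀ y ∈ Y0, ∀ v, v ∉ regionEdges w Y →
      (∀ i, |frameCell (refineFrame K b w) v i - y i| ≤ j * (2 * n + 1)) → σ v = σ' v := by
    intro y hy v hv hnear
    have hyb := Fintype.mem_piFinset.1 (hbox hy)
    have hvc := mem_cellEdges_frameCell hw1 v
    have hcY : frameCell w v ∉ Y := fun h => hv (Finset.mem_biUnion.2 ⟨_, h, hvc⟩)
    have hcW : frameCell w v ∈ windowCells n' := by
      rw [frameCell_eq_ediv_frameCell_refineFrame hK1 hb hw']
      simp only [Summit.QuantumFields.YangMills.Cruxes.IR.Tempered.windowCells, Fintype.mem_piFinset, Finset.mem_Icc]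
      intro i
      have hyi := Finset.mem_Ico.1 (hyb i)
      have hvi := abs_le.1 (hnear i)
      have hK2 : (j : ℤ) * (2 * (n : ℤ) + 1) ≤ 2 * (K : ℤ) := by exact_mod_cast hK
      have hn1 : (1 : ℤ) ≤ (n' : ℤ) := by exact_mod_cast hn'
      have hlo : -2 ≤ frameCell (refineFrame K b w) v i / (K : ℤ) := Int.le_ediv_of_mul_le hKpos (by linarith)
      have hhi : frameCell (refineFrame K b w) v i / (K : ℤ) < 3 := Int.ediv_lt_of_lt_mul hKpos (by linarith)
      constructor <;> linarith
    exact hagree (frameCell w v) (windowCells_subset_windowCellsPlus _ hcW) hcY hcW v hvc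
  have hmain := multiCell_influence_general (V := ZdEdge 4) (S := G) (C := Cell) (cell := frameCell (refineFrame K b w))
    (near := fun y v => ∀ i, |frameCell (refineFrame K b w) v i - y i| ≤ j * (2 * n + 1))
    (fun v i => by rw [sub_self, abs_zero]; positivity) hγ hR Y0 (regionEdges w Y) (regionEdges_union_refine hK1 hb hw' Y) f hfm hf01 hdep
    σ σ' hagree'
  refine hmain.trans ?_
  have hc : (Y0.card : ℝ) ≤ (K : ℝ) ^ 4 := by exact_mod_cast card_fineCells_centre_le hK1 hb hw'
  exact mul_le_mul_of_nonneg_right hc hθ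

/-- ★ **Cofinality at any window and tolerance.**  `UnivShellCond ρ β b n ε` with `0 ≤ ε`, `ε·shellCount n < 1`, `b ≥ 1`; `n' ≥ 1`, `ε' > 0` ⇒ `∃ K₀, ∀ K ≥ K₀,
UnivShellCond ρ β (K·b) n' ε'`. -/
theorem univShellCond_cofinal_window (hρ : Continuous ρ) {β ε : ℝ} {b n : ℕ} (hb : 1 ≤ b) (hε : 0 ≤ ε)
    (hlt : ε * shellCount n < 1) (hU : UnivShellCond ρ β b n ε) {n' : ℕ} (hn' : 1 ≤ n') {ε' : ℝ} (hε' : 0 < ε') :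
    ∃ K₀ : ℕ, ∀ K : ℕ, K₀ ≤ K → UnivShellCond ρ β (K * b) n' ε' := by
  have hθ0 : 0 ≤ ε * shellCount n := mul_nonneg hε (shellCount_nonneg' n)
  have hT := pow_four_mul_geom_tendsto_zero hθ0 hlt (2 * n + 1) (2 * n + 1) 1
  obtain ⟨j₀, hj₀⟩ := eventually_atTop.1 (hT.eventually (gt_mem_nhds hε'))
  refine ⟨j₀ * (2 * n + 1) + 1, fun K hK => ?_⟩
  have hpos : 0 < 2 * n + 1 := by omega
  have hjK : 2 * K / (2 * n + 1) * (2 * n + 1) ≤ 2 * K := Nat.div_mul_le_self (2 * K) (2 * n + 1)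
  have hlt' : 2 * K < 2 * K / (2 * n + 1) * (2 * n + 1) + (2 * n + 1) := Nat.lt_div_mul_add hpos
  have hKj : K ≤ (2 * K / (2 * n + 1) * (2 * n + 1) + (2 * n + 1)) * 1 := by omega
  have hj₀j : j₀ ≤ 2 * K / (2 * n + 1) := (Nat.le_div_iff_mul_le hpos).2 (by omega)
  have hK1 : 1 ≤ K := by omega
  have hUc := univShellCond_coarsen_window ρ hρ hb hε hU hn' (2 * K / (2 * n + 1)) hK1 hjK
  set j : ℕ := 2 * K / (2 * n + 1) with hj
  refine univShellCond_of_le ρ hUc ?_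
  have hθj : 0 ≤ (ε * shellCount n) ^ j := pow_nonneg hθ0 j
  have hKle : (K : ℝ) ≤ ((((j * (2 * n + 1) + (2 * n + 1)) * 1 : ℕ)) : ℝ) := by exact_mod_cast hKj
  have hK0 : (0 : ℝ) ≤ (K : ℝ) := Nat.cast_nonneg K
  calc (K : ℝ) ^ 4 * (ε * shellCount n) ^ j ≤ ((((j * (2 * n + 1) + (2 * n + 1)) * 1 : ℕ)) : ℝ) ^ 4 * (ε * shellCount n) ^ j := by gcongr
    _ ≤ ε' := (hj₀ j hj₀j).le

/-! ## §2 Grade robustness of the universal onset -/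

/-- ★ **The universal onset is GRADE-ROBUST (per `(G, ρ)`).**  A universal onset at SOME admissible grade `(n, ε)` (`0 ≤ ε`, `ε·shellCount n < 1`) gives the
universal onset at EVERY grade `(n', ε')` with `n' ≥ 1`, `ε' > 0` — with the same `β₂` and meshes that are multiples of the given ones. -/
theorem univOnsetAt_grade_robust (hρ : Continuous ρ)
    (h : ∃ (n : ℕ) (ε : ℝ), 0 ≤ ε ∧ ε * shellCount n < 1 ∧ ∃ β₂ : ℝ, ∀ β : ℝ, β₂ ≤ β → ∃ b : ℕ, 1 ≤ b ∧ UnivShellCond ρ β b n ε)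
    {n' : ℕ} (hn' : 1 ≤ n') {ε' : ℝ} (hε' : 0 < ε') :
    ∃ β₂ : ℝ, ∀ β : ℝ, β₂ ≤ β → ∃ b : ℕ, 1 ≤ b ∧ UnivShellCond ρ β b n' ε' := by
  obtain ⟨n, ε, hε, hlt, β₂, hβ⟩ := h
  refine ⟨β₂, fun β hb => ?_⟩
  obtain ⟨b, hb1, hU⟩ := hβ β hb
  obtain ⟨K₀, hK₀⟩ := univShellCond_cofinal_window ρ hρ hb1 hε hlt hU hn' hε'
  refine ⟨(K₀ + 1) * b, ?_, hK₀ (K₀ + 1) (Nat.le_succ K₀)⟩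
  exact hb1.trans (Nat.le_mul_of_pos_left b (Nat.succ_pos K₀))

/-- **Canonical single-grade form (per `(G, ρ)`)**: «universal onset at some admissible `(n, ε)`» ↔ «universal onset at `(1, 1∕3552)`». -/
theorem univOnsetAt_iff_grade_one (hρ : Continuous ρ) :
    (∃ (n : ℕ) (ε : ℝ), 1 ≤ n ∧ 0 ≤ ε ∧ ε * shellCount n < 1 ∧ ∃ β₂ : ℝ, ∀ β : ℝ, β₂ ≤ β → ∃ b : ℕ, 1 ≤ b ∧ UnivShellCond ρ β b n ε) ↔
      ∃ β₂ : ℝ, ∀ β : ℝ, β₂ ≤ β → ∃ b : ℕ, 1 ≤ b ∧ UnivShellCond ρ β b 1 (1 / 3552) := by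
  constructor
  · rintro ⟨n, ε, -, hε, hlt, hrest⟩
    exact univOnsetAt_grade_robust ρ hρ ⟨n, ε, hε, hlt, hrest⟩ le_rfl (by norm_num)
  · intro h
    exact ⟨1, 1 / 3552, le_rfl, by norm_num, by rw [shellCount_one]; norm_num, h⟩

end CoarsenWindow

/-! ## §3 The universal onset statement `OnsetMixing` in canonical form -/

/-- ★ **`OnsetMixing` in canonical single-grade form**: `OnsetMixing ↔` «for every compact simple `G` and every lattice representation `r`:
`∃ β₂, ∀ β ≥ β₂, ∃ b ≥ 1, UnivShellCond r.ρ β b 1 (1∕3552)`» — the grade `(n, ε)` of the expired universal stub is immaterial. -/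
theorem onsetMixing_iff_grade_one :
    OnsetMixing ↔
      ∀ (G : Type) [Group G] [TopologicalSpace G] [IsTopologicalGroup G] [CompactSpace G],
        IsCompactSimpleLieGroup G →
        letI : MeasurableSpace G := borel G; haveI : BorelSpace G := ⟨rfl⟩;
        ∀ r : LatticeRep G, ∃ β₂ : ℝ, ∀ β : ℝ, β₂ ≤ β → ∃ b : ℕ, 1 ≤ b ∧ UnivShellCond r.ρ β b 1 (1 / 3552) := by
  constructor
  · intro h G _ _ _ _ hG
    letI : MeasurableSpace G := borel G
    haveI : BorelSpace G := ⟨rfl⟩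
    intro r
    haveI := r.t2Space
    haveI := r.secondCountableTopology
    exact (univOnsetAt_iff_grade_one r.ρ r.continuous).1 (h G hG r)
  · intro h G _ _ _ _ hG
    letI : MeasurableSpace G := borel G
    haveI : BorelSpace G := ⟨rfl⟩
    intro r
    haveI := r.t2Space
    haveI := r.secondCountableTopology
    exact (univOnsetAt_iff_grade_one r.ρ r.continuous).2 (h G hG r)

end Summit.QuantumFields.YangMills.Cruxes.IR.BlockedActivity

end
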